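import Summits.Ventures.DiscreteObjects.PP12.FlagSevenRowOrbits

/-!
# The `f = 7` flag-cell orbit matrix: the shape conjuncts 2–5 of `IsFlagSevenOrbitMatrix` for the data of a plane (kernel; Step D₁)
Framing: lottery ticket; floor = certified bounds/negative ranges.

Cell pub-namedobj (venture DiscreteObjects), target (M), designs gen 14. Setting as in `FlagSevenOrbitDataOfPlane`. For
`D := flagSevenDataOfPlane …` (orbit data READ OFF a putative projective plane of order 12 with a flag-type collineation `σ`, `σ³ = 1`, `f = 7`):
* `card_triangles_meeting_line` — a line `a ∌ c` meeting every triangle of class `s` at most once meets EXACTLY THREE of them (one on each of the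
  three c-lines `cl s, σ(cl s), σ²(cl s)`);
* conjunct 2 `flagSevenDataOfPlane_R_card` (`|R s i| = 3`), conjunct 3 `flagSevenDataOfPlane_C_card` (`|C k t s| = 3`), conjunct 4
  `flagSevenDataOfPlane_C_unique` (every triangle lies on exactly one T-line orbit through `y_k`), conjunct 5 `flagSevenDataOfPlane_beta_bijective`.
Remaining (Step D₂): the row and column sums (`orbit_row_identity_orbits` / `orbit_column_identity_orbits` along `colOrbit` / `rowOrbit`) and the
assembly `FlagSevenOrbitReduction`. No `sorry`, no new axioms.
-/

namespace Summit.Ventures.DiscreteObjects.PP12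

open Configuration Finset
open scoped Classical

namespace Collineation

variable {P L : Type*} [Membership P L] [ProjectivePlane P L] [Fintype P] [Fintype L] (σ : Collineation P L)

section Flag

variable {l : L} {c : P} (hl : σ.onLines l = l) (hc : σ.onPoints c = c) (hcl : c ∈ l)
  (hP : ∀ p : P, σ.onPoints p = p → p ∈ l) (hL : ∀ m : L, σ.onLines m = m → c ∈ m)
  (h12 : ProjectivePlane.order P L = 12)

section Data

variable (hl : σ.onLines l = l) (hc : σ.onPoints c = c) (hcl : c ∈ l)
  (hP : ∀ p : P, σ.onPoints p = p → p ∈ l) (hL : ∀ m : L, σ.onLines m = m → c ∈ m) (h12 : ProjectivePlane.order P L = 12)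
  (hq : σ.onPoints ^ 3 = 1) (hf : fixedCard σ.onPoints = 7) {u₀ u₁ : L} (hcu₀ : c ∈ u₀) (hu₀ : σ.onLines u₀ ≠ u₀)
  (hcu₁ : c ∈ u₁) (hu₁ : σ.onLines u₁ ≠ u₁)

include hc hq in
/-- **A line `a ∌ c` meeting every triangle of class `s` at most once meets exactly three of them** — through its points on the three
c-lines `cl s, σ(cl s), σ²(cl s)` (all `≠ c`, hence exterior, in three different triangles). -/
theorem card_triangles_meeting_line (s : Fin 2) {a : L} (hca : c ∉ a)
    (hle : ∀ x : TriIdx (P := P) c (cl u₀ u₁ s), ((orb3 σ.onPoints x.1).filter fun q => q ∈ a).card ≤ 1) :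
    (univ.filter fun i : Fin 12 => ∃ Q ∈ orb3 σ.onPoints (σ.eTri7 h12 hcu₀ hu₀ hcu₁ hu₁ s i).1, Q ∈ a).card = 3 := by
  have hqL : σ.onLines ^ 3 = 1 := σ.onLines_pow_eq_one hq
  have h3 := apply_three σ.onPoints hq
  have h3L := apply_three σ.onLines hqL
  set e := σ.eTri7 h12 hcu₀ hu₀ hcu₁ hu₁ s with he
  obtain ⟨hcu, hnu⟩ := σ.cl_spec hcu₀ hu₀ hcu₁ hu₁ s
  have hcσ : ∀ v : L, c ∈ v → c ∈ σ.onLines v := fun v hv => by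
    have := σ.mem_map hv; rw [hc] at this; exact this
  have hcu1 : c ∈ σ.onLines (cl u₀ u₁ s) := hcσ _ hcu
  have hcu2 : c ∈ σ.onLines (σ.onLines (cl u₀ u₁ s)) := hcσ _ hcu1
  have hau0 : a ≠ cl u₀ u₁ s := fun e0 => hca (e0 ▸ hcu)
  have hau1 : a ≠ σ.onLines (cl u₀ u₁ s) := fun e0 => hca (e0 ▸ hcu1)
  have hau2 : a ≠ σ.onLines (σ.onLines (cl u₀ u₁ s)) := fun e0 => hca (e0 ▸ hcu2)
  -- the three meeting points and their vertices on `cl s`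
  obtain ⟨hq0a, hq0u⟩ := meetPt_spec c hau0
  obtain ⟨hq1a, hq1u⟩ := meetPt_spec c hau1
  obtain ⟨hq2a, hq2u⟩ := meetPt_spec c hau2
  set q0 := meetPt c a (cl u₀ u₁ s) with hq0
  set q1 := meetPt c a (σ.onLines (cl u₀ u₁ s)) with hq1
  set q2 := meetPt c a (σ.onLines (σ.onLines (cl u₀ u₁ s))) with hq2
  have hq0c : q0 ≠ c := fun e0 => hca (e0 ▸ hq0a)
  have hq1c : q1 ≠ c := fun e0 => hca (e0 ▸ hq1a)
  have hq2c : q2 ≠ c := fun e0 => hca (e0 ▸ hq2a)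
  -- vertices: v0 = q0, v1 = σ² q1, v2 = σ q2 (all on `cl s`)
  have hv1u : σ.onPoints (σ.onPoints q1) ∈ cl u₀ u₁ s := by
    have := σ.mem_map (σ.mem_map hq1u); rw [h3L] at this; exact this
  have hv2u : σ.onPoints q2 ∈ cl u₀ u₁ s := by
    have := σ.mem_map hq2u; rw [h3L] at this; exact this
  have hv1c : σ.onPoints (σ.onPoints q1) ≠ c := by
    intro e0; apply hq1c; apply σ.onPoints.injective; apply σ.onPoints.injective; rw [e0, hc, hc]
  have hv2c : σ.onPoints q2 ≠ c := by
    intro e0; apply hq2c; apply σ.onPoints.injective; rw [e0, hc]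
  set j0 : Fin 12 := e.symm ⟨q0, hq0u, hq0c⟩ with hj0
  set j1 : Fin 12 := e.symm ⟨σ.onPoints (σ.onPoints q1), hv1u, hv1c⟩ with hj1
  set j2 : Fin 12 := e.symm ⟨σ.onPoints q2, hv2u, hv2c⟩ with hj2
  have hej0 : (e j0).1 = q0 := by rw [hj0, Equiv.apply_symm_apply]
  have hej1 : (e j1).1 = σ.onPoints (σ.onPoints q1) := by rw [hj1, Equiv.apply_symm_apply]
  have hej2 : (e j2).1 = σ.onPoints q2 := by rw [hj2, Equiv.apply_symm_apply]
  -- the q_k are points of the orbits of the v_k lying on a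
  have hq0o : q0 ∈ orb3 σ.onPoints (e j0).1 := by rw [hej0]; exact self_mem_orb3 _ _
  have hq1o : q1 ∈ orb3 σ.onPoints (e j1).1 := by
    rw [hej1, mem_orb3]; right; left; rw [h3]
  have hq2o : q2 ∈ orb3 σ.onPoints (e j2).1 := by
    rw [hej2, mem_orb3]; right; right; rw [h3]
  -- two distinct q's in the orbit of one vertex contradict `hle`
  have two : ∀ {x : TriIdx (P := P) c (cl u₀ u₁ s)} {p p' : P}, p ≠ p' → p ∈ orb3 σ.onPoints x.1 → p ∈ a →
      p' ∈ orb3 σ.onPoints x.1 → p' ∈ a → False := by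
    intro x p p' hne hp hpa hp' hp'a
    have hsub : ({p, p'} : Finset P) ⊆ (orb3 σ.onPoints x.1).filter fun q => q ∈ a := by
      intro z hz; rw [mem_insert, mem_singleton] at hz; rw [mem_filter]
      rcases hz with rfl | rfl
      · exact ⟨hp, hpa⟩
      · exact ⟨hp', hp'a⟩
    have := card_le_card hsub
    rw [card_pair hne] at this
    have := hle x; omega
  -- the three q's are pairwise distinct (they lie on distinct lines through c)
  have hu01 : cl u₀ u₁ s ≠ σ.onLines (cl u₀ u₁ s) := fun e0 => hnu e0.symm
  have hu12 : σ.onLines (cl u₀ u₁ s) ≠ σ.onLines (σ.onLines (cl u₀ u₁ s)) := fun e0 => hnu (σ.onLines.injective e0).symm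
  have hu02 : cl u₀ u₁ s ≠ σ.onLines (σ.onLines (cl u₀ u₁ s)) := by
    intro e0; apply hnu
    have : σ.onLines (σ.onLines (σ.onLines (cl u₀ u₁ s))) = σ.onLines (cl u₀ u₁ s) := by rw [← e0]
    rw [h3L] at this; exact this.symm
  have hq01 : q0 ≠ q1 := fun e0 => hq0c ((Nondegenerate.eq_or_eq hq0u hcu (e0 ▸ hq1u) hcu1).resolve_right hu01)
  have hq12 : q1 ≠ q2 := fun e0 => hq1c ((Nondegenerate.eq_or_eq hq1u hcu1 (e0 ▸ hq2u) hcu2).resolve_right hu12)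
  have hq02 : q0 ≠ q2 := fun e0 => hq0c ((Nondegenerate.eq_or_eq hq0u hcu (e0 ▸ hq2u) hcu2).resolve_right hu02)
  have hj01 : j0 ≠ j1 := fun e0 => two hq01 hq0o hq0a (by rw [e0]; exact hq1o) hq1a
  have hj12 : j1 ≠ j2 := fun e0 => two hq12 hq1o hq1a (by rw [e0]; exact hq2o) hq2a
  have hj02 : j0 ≠ j2 := fun e0 => two hq02 hq0o hq0a (by rw [e0]; exact hq2o) hq2a
  -- the filter is exactly {j0, j1, j2}
  have hset : (univ.filter fun i : Fin 12 => ∃ Q ∈ orb3 σ.onPoints (e i).1, Q ∈ a) = {j0, j1, j2} := by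
    ext i
    rw [mem_filter, mem_insert, mem_insert, mem_singleton]
    constructor
    · rintro ⟨-, Q, hQ, hQa⟩
      -- Q = σ^k (e i).1 lies on σ^k (cl s) ∩ a, so Q = q_k and (e i).1 = v_k
      have hxu : (e i).1 ∈ cl u₀ u₁ s := (e i).2.1
      have vert : ∀ {v : P}, v ∈ cl u₀ u₁ s → v ∈ orb3 σ.onPoints (e i).1 → ∀ {j : Fin 12}, (e j).1 = v → i = j := by
        intro v hvu hvo j hjv
        have : (e j).1 = (e i).1 := by
          rw [hjv]; exact σ.vertex_eq_of_mem_orb3 hc hq hcu hnu hvu hxu hvo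
        exact (e.injective (Subtype.ext this)).symm
      rw [mem_orb3] at hQ
      rcases hQ with e0 | e0 | e0
      · left
        have hQq : Q = q0 := meetPt_eq c hau0 hQa (e0 ▸ hxu)
        exact vert hq0u (by rw [← hQq, e0]; exact self_mem_orb3 _ _) hej0
      · right; left
        have hQq : Q = q1 := meetPt_eq c hau1 hQa (e0 ▸ σ.mem_map hxu)
        refine vert hv1u ?_ hej1
        rw [← hQq, e0, h3]; exact self_mem_orb3 _ _
      · right; right
        have hQq : Q = q2 := meetPt_eq c hau2 hQa (e0 ▸ σ.mem_map (σ.mem_map hxu))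
        refine vert hv2u ?_ hej2
        rw [← hQq, e0, h3]; exact self_mem_orb3 _ _
    · rintro (rfl | rfl | rfl)
      · exact ⟨mem_univ _, q0, hq0o, hq0a⟩
      · exact ⟨mem_univ _, q1, hq1o, hq1a⟩
      · exact ⟨mem_univ _, q2, hq2o, hq2a⟩
  rw [hset, card_insert_of_notMem, card_insert_of_notMem, card_singleton]
  · rw [mem_singleton]; exact hj12
  · rw [mem_insert, mem_singleton, not_or]; exact ⟨hj01, hj02⟩

/-- **Conjunct 2:** `|R s i| = 3` — the side of a triangle of class `s` meets exactly three triangles of the other class. -/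
theorem flagSevenDataOfPlane_R_card (h01 : u₁ ∉ orb3 σ.onLines u₀) (s : Fin 2) (i : Fin 12) :
    ((σ.flagSevenDataOfPlane hl hc hcl hP hL h12 hq hf hcu₀ hu₀ hcu₁ hu₁).R s i).card = 3 := by
  set x := σ.eTri7 h12 hcu₀ hu₀ hcu₁ hu₁ s i with hx
  have hxX := σ.exterior_of_triIdx s x hcu₀ hu₀ hcu₁ hu₁ hL
  have hxf : σ.onPoints x.1 ≠ x.1 := σ.not_fixed_of_exterior_flag hl hP hxX
  obtain ⟨hxa, hσxa⟩ := σ.sideOf_spec l hxf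
  obtain ⟨-, ha0⟩ := σ.side_no_fixed_point hxf hxX hxa hσxa
  have hca : c ∉ σ.sideOf l x.1 := fun h => ha0 c hc h
  have hR : (σ.flagSevenDataOfPlane hl hc hcl hP hL h12 hq hf hcu₀ hu₀ hcu₁ hu₁).R s i = univ.filter fun i' : Fin 12 =>
      ∃ q ∈ orb3 σ.onPoints (σ.eTri7 h12 hcu₀ hu₀ hcu₁ hu₁ (1 - s) i').1, q ∈ σ.sideOf l x.1 := rfl
  rw [hR]
  apply σ.card_triangles_meeting_line hc h12 hq hcu₀ hu₀ hcu₁ hu₁ (1 - s) hca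
  -- a class-(1-s) triangle meets the side at most once (two points would make the side one of ITS sides)
  intro x'
  by_contra hlt
  obtain ⟨Q, hQx', -, hQa, hσQa⟩ := σ.exists_consecutive_of_two_le hq (a := σ.sideOf l x.1) (q := x'.1) (by omega)
  have hQx : Q = x.1 := σ.side_unique hxX hxa hσxa hQa hσQa
  rw [hQx] at hQx'
  have hss : s ≠ 1 - s := by
    have key : ∀ a : Fin 2, a ≠ 1 - a := by decide
    exact key s
  exact σ.triIdx_class_unique hc hq hcu₀ hu₀ hcu₁ h01 hss x' hQx' x.2.1 x.2.2

/-- **Conjunct 3:** `|C k t s| = 3` — a T-line orbit through `y_k` carries the vertices of exactly three triangles of each class. -/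
theorem flagSevenDataOfPlane_C_card (k : Fin 6) (t : Fin 4) (s : Fin 2) :
    ((σ.flagSevenDataOfPlane hl hc hcl hP hL h12 hq hf hcu₀ hu₀ hcu₁ hu₁).C k t s).card = 3 := by
  set y := σ.eFixP6 hl hc hf k with hy
  obtain ⟨hyb, hbl, hborb⟩ := σ.lineRep_tline_spec hl hc hcl hP hL h12 hq hf hcu₀ hu₀ hcu₁ hu₁ k t
  set b := σ.lineRep hl hc hcl hP hL h12 hq hf hcu₀ hu₀ hcu₁ hu₁ (Sum.inr (Sum.inr (k, t))) with hb
  have hcb : c ∉ b := σ.c_not_mem_tline hcl hP y.2.1 y.2.2 hyb hbl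
  have hC : (σ.flagSevenDataOfPlane hl hc hcl hP hL h12 hq hf hcu₀ hu₀ hcu₁ hu₁).C k t s
      = univ.filter fun i₀ : Fin 12 => σ.cOrb l y.1 (σ.eTri7 h12 hcu₀ hu₀ hcu₁ hu₁ s i₀).1 = ((σ.eLOrb hl hcl hP hL h12 hq y) t).1 := rfl
  have hset : (σ.flagSevenDataOfPlane hl hc hcl hP hL h12 hq hf hcu₀ hu₀ hcu₁ hu₁).C k t s
      = univ.filter fun i₀ : Fin 12 => ∃ Q ∈ orb3 σ.onPoints (σ.eTri7 h12 hcu₀ hu₀ hcu₁ hu₁ s i₀).1, Q ∈ b := by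
    rw [hC]; ext i₀; simp only [mem_filter, mem_univ, true_and]
    rw [← hborb]
    exact σ.cOrb_eq_iff hl hP hq (σ.exterior_of_triIdx s (σ.eTri7 h12 hcu₀ hu₀ hcu₁ hu₁ s i₀) hcu₀ hu₀ hcu₁ hu₁ hL) y.2.1 hyb
  rw [hset]
  exact σ.card_triangles_meeting_line hc h12 hq hcu₀ hu₀ hcu₁ hu₁ s hcb (fun x => σ.tline_orbit_simple hcl hP hL hq y.2.1 y.2.2 hyb hbl x.1)

/-- **Conjunct 4:** for fixed `k, s`, every triangle `i` of class `s` lies in exactly one `C k t s` (the orbit of the line `x_i·y_k`). -/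
theorem flagSevenDataOfPlane_C_unique (k : Fin 6) (s : Fin 2) (i : Fin 12) :
    (univ.filter fun t : Fin 4 => i ∈ (σ.flagSevenDataOfPlane hl hc hcl hP hL h12 hq hf hcu₀ hu₀ hcu₁ hu₁).C k t s).card = 1 := by
  set y := σ.eFixP6 hl hc hf k with hy
  set x := σ.eTri7 h12 hcu₀ hu₀ hcu₁ hu₁ s i with hx
  set eB := σ.eLOrb hl hcl hP hL h12 hq y with heB
  have hxX := σ.exterior_of_triIdx s x hcu₀ hu₀ hcu₁ hu₁ hL
  have hC : ∀ t : Fin 4, (σ.flagSevenDataOfPlane hl hc hcl hP hL h12 hq hf hcu₀ hu₀ hcu₁ hu₁).C k t s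
      = univ.filter fun i₀ : Fin 12 => σ.cOrb l y.1 (σ.eTri7 h12 hcu₀ hu₀ hcu₁ hu₁ s i₀).1 = (eB t).1 := fun t => rfl
  set t₀ : Fin 4 := eB.symm ⟨σ.cOrb l y.1 x.1, (σ.cOrb_mem hl hP hxX y.2.1).1⟩ with ht₀
  rw [card_eq_one]
  refine ⟨t₀, ?_⟩
  ext t
  rw [mem_filter, mem_singleton, hC, mem_filter]
  constructor
  · rintro ⟨-, -, h⟩
    apply eB.injective
    rw [ht₀, Equiv.apply_symm_apply]
    exact Subtype.ext h.symm
  · intro h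
    refine ⟨mem_univ _, mem_univ _, ?_⟩
    rw [h, ht₀, Equiv.apply_symm_apply]

/-- **Conjunct 5:** every `t ↦ β k t j` is a bijection of `Fin 4` (`betaOrb_injective`). -/
theorem flagSevenDataOfPlane_beta_bijective (k : Fin 6) (j : Fin 6) :
    Function.Bijective fun t => (σ.flagSevenDataOfPlane hl hc hcl hP hL h12 hq hf hcu₀ hu₀ hcu₁ hu₁).β k t j := by
  apply (Finite.injective_iff_bijective).1
  intro t t' h
  set y := σ.eFixP6 hl hc hf k with hy
  set m := σ.eFixL6 hl hc hf j with hm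
  set eO := σ.eOrbOn hc hcl hP hL h12 hq m with heO
  set eB := σ.eLOrb hl hcl hP hL h12 hq y with heB
  have hβ : ∀ s : Fin 4, (σ.flagSevenDataOfPlane hl hc hcl hP hL h12 hq hf hcu₀ hu₀ hcu₁ hu₁).β k s j
      = eO.symm ⟨σ.betaOrb c m.1 (eB s).1, by
          obtain ⟨b, hb, hbeq⟩ := mem_image.1 (eB s).2
          rw [mem_filter] at hb
          rw [← hbeq]
          exact σ.betaOrb_mem hc hcl hP hL hq y.2.1 y.2.2 hb.2.1 hb.2.2 m.2.1 m.2.2⟩ := fun s => rfl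
  have h' : (σ.flagSevenDataOfPlane hl hc hcl hP hL h12 hq hf hcu₀ hu₀ hcu₁ hu₁).β k t j
      = (σ.flagSevenDataOfPlane hl hc hcl hP hL h12 hq hf hcu₀ hu₀ hcu₁ hu₁).β k t' j := h
  rw [hβ, hβ] at h'
  have hval : σ.betaOrb c m.1 (eB t).1 = σ.betaOrb c m.1 (eB t').1 := by
    have := congrArg Subtype.val (eO.symm.injective h'); exact this
  obtain ⟨b, hb, hbeq⟩ := mem_image.1 (eB t).2
  obtain ⟨b', hb', hb'eq⟩ := mem_image.1 (eB t').2
  rw [mem_filter] at hb hb'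
  rw [← hbeq, ← hb'eq] at hval
  have horb := σ.betaOrb_injective hc hcl hP hL hq y.2.1 y.2.2 m.2.1 m.2.2 hb.2.1 hb.2.2 hb'.2.1 hb'.2.2 hval
  have : eB t = eB t' := Subtype.ext (by rw [← hbeq, ← hb'eq, horb])
  exact eB.injective this

end Data

end Flag

end Collineation

end Summit.Ventures.DiscreteObjects.PP12
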